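import Summits.KontsevichZagierPeriods.KontsevichZagierPeriods.Theorems.RootDecompZetaThreeFrontierWordMatchPreludeP15

/-! # `RootDecompZetaThreeFrontierWordMatchPreludeP16` — part 2/3 of the ≤340-line split of decomp-kz lens-1 g12 `s44_s46_delta.lean`
(sha256 4eadf8a5…; = §44–§46 of `MatchPrelude_v8.lean`: the proof of `…GZLadder.stub_gapClassMatch : GapClassMatch` of «gz_ladder» v4 on
stmt-KontsevichZagierPeriods-32433, proved in part 3/3 = P17).  Sits on the landed WordMatchPrelude P1–P14 (§24–§43).  Mathematics unchanged. -/

set_option linter.dupNamespace false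

noncomputable section

/-! # §45  THE RULES OF THE DECISION LIST AS CLAUSE TRANSFORMERS (decomp-kz lens-1 gen 12).  `Adm κ B` = the five order conditions,
`GClause κ B` = the `GapClassMatch` clause of the exponent datum `(κ, B)` for every scale `q`.  Each rule of NODE.md ADDENDUM 9/10 becomes
`(clauses of the pieces) → clause of the class`: the splits D1, D2, D7, D8, D9 (§39), the free directions D4 (§34), the layer terminal, the
σ₃-duality (§43, used for every primed rule), the engine rules D6 (§41/§42) and — new — D5, D3 in both homogenisation cases (§44). -/

namespace Summit.KontsevichZagierPeriods.KontsevichZagierPeriods.Cruxes.GZNormalFormWThree.GZLadder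

open Set MeasureTheory Literature.NumberTheory.Transcendental
open Summit.KontsevichZagierPeriods.RootDecompZetaThreeFrontier
open Summit.KontsevichZagierPeriods.KontsevichZagierPeriods.Theorems.RootDecompZetaThreeFrontierWordMoves (measurableSet_simplex)

section GapClassRules

/-- the five order conditions (sector criterion) of the gap class `(κ, (β₀,β₁,γ₁,γ₂,α))` -/
def Adm (κ : Fin 4 → ℕ) (β₀ β₁ γ₁ γ₂ α : ℕ) : Prop :=
  β₀ + β₁ + α ≤ κ 1 + κ 2 + κ 3 + 2 ∧ β₁ ≤ κ 2 + κ 3 + 1 ∧ α ≤ κ 1 + κ 2 + 1 ∧ γ₁ ≤ κ 0 + κ 1 + 1 ∧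
    γ₂ + γ₁ + α ≤ κ 0 + κ 1 + κ 2 + 2

/-- the `GapClassMatch` clause of the exponent datum `(κ, (β₀,β₁,γ₁,γ₂,α))`, for every scale `q` -/
def GClause (κ : Fin 4 → ℕ) (β₀ β₁ γ₁ γ₂ α : ℕ) : Prop :=
  ∀ (q : ℚ) (s : KZ.IntegralRep 3), s.domain = simplex 3 →
    EqOn s.integrand (fun t => (q : ℝ) * WordLayer.gapF κ β₀ β₁ γ₁ γ₂ α t) s.domain → CongInto (layerThree ∪ gzLETwo) (KZ.of s)

/-- an exponent vector as a `Finsupp` -/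
noncomputable def fs (κ : Fin 4 → ℕ) : Fin 4 →₀ ℕ := Finsupp.equivFunOnFinite.symm κ

/-- Auxiliary step `coe_fs` (§45): coe fs. [bookkeeping] -/
@[simp] theorem coe_fs (κ : Fin 4 → ℕ) : ⇑(fs κ) = κ := by
  simp [fs]

/-- Auxiliary step `layerF_toT_monomial_fs` (§45): layer F to T monomial fs. [bookkeeping] -/
theorem layerF_toT_monomial_fs (κ : Fin 4 → ℕ) (q : ℚ) (β₀ β₁ γ₁ γ₂ α : ℕ) :
    WordLayer.layerF (WordLayer.toT (MvPolynomial.monomial (fs κ) q)) β₀ β₁ γ₁ γ₂ α =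
      fun t => (q : ℝ) * WordLayer.gapF κ β₀ β₁ γ₁ γ₂ α t := by
  funext t
  rw [WordLayer.layerF_toT_monomial, coe_fs]

/-- a PIECE: an admissible exponent datum whose clause holds supplies the two hypotheses (integrability, congruence) of the split steps -/
theorem piece (κ : Fin 4 → ℕ) (q : ℚ) (β₀ β₁ γ₁ γ₂ α : ℕ) (hA : Adm κ β₀ β₁ γ₁ γ₂ α) (hG : GClause κ β₀ β₁ γ₁ γ₂ α) :
    IntegrableOn (WordLayer.layerF (WordLayer.toT (MvPolynomial.monomial (fs κ) q)) β₀ β₁ γ₁ γ₂ α) (KZ.openOrderedSimplex 3) ∧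
    ∀ s : KZ.IntegralRep 3, s.domain = simplex 3 →
      EqOn s.integrand (WordLayer.layerF (WordLayer.toT (MvPolynomial.monomial (fs κ) q)) β₀ β₁ γ₁ γ₂ α) s.domain →
      CongInto (layerThree ∪ gzLETwo) (KZ.of s) := by
  rw [layerF_toT_monomial_fs]
  exact ⟨(WordLayer.gapClass_integrableOn κ hA.1 hA.2.1 hA.2.2.1 hA.2.2.2.1 hA.2.2.2.2).const_mul _, hG q⟩

/-- a piece with negated gap-world numerator -/
theorem piece_neg (κ : Fin 4 → ℕ) (q : ℚ) (β₀ β₁ γ₁ γ₂ α : ℕ) (hA : Adm κ β₀ β₁ γ₁ γ₂ α) (hG : GClause κ β₀ β₁ γ₁ γ₂ α) :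
    IntegrableOn (WordLayer.layerF (WordLayer.toT (-MvPolynomial.monomial (fs κ) q)) β₀ β₁ γ₁ γ₂ α) (KZ.openOrderedSimplex 3) ∧
    ∀ s : KZ.IntegralRep 3, s.domain = simplex 3 →
      EqOn s.integrand (WordLayer.layerF (WordLayer.toT (-MvPolynomial.monomial (fs κ) q)) β₀ β₁ γ₁ γ₂ α) s.domain →
      CongInto (layerThree ∪ gzLETwo) (KZ.of s) := by
  have e : -MvPolynomial.monomial (fs κ) q = MvPolynomial.monomial (fs κ) (-q) := by simp
  rw [e]
  exact piece κ (-q) β₀ β₁ γ₁ γ₂ α hA hG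

/-- a piece with negated `t`-world numerator -/
theorem piece_negT (κ : Fin 4 → ℕ) (q : ℚ) (β₀ β₁ γ₁ γ₂ α : ℕ) (hA : Adm κ β₀ β₁ γ₁ γ₂ α) (hG : GClause κ β₀ β₁ γ₁ γ₂ α) :
    IntegrableOn (WordLayer.layerF (-WordLayer.toT (MvPolynomial.monomial (fs κ) q)) β₀ β₁ γ₁ γ₂ α) (KZ.openOrderedSimplex 3) ∧
    ∀ s : KZ.IntegralRep 3, s.domain = simplex 3 →
      EqOn s.integrand (WordLayer.layerF (-WordLayer.toT (MvPolynomial.monomial (fs κ) q)) β₀ β₁ γ₁ γ₂ α) s.domain →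
      CongInto (layerThree ∪ gzLETwo) (KZ.of s) := by
  rw [← map_neg]
  exact piece_neg κ q β₀ β₁ γ₁ γ₂ α hA hG

/-- **the LAYER terminal** -/
theorem glayer (κ : Fin 4 → ℕ) (β₀ β₁ γ₁ γ₂ α : ℕ) (hα : α ≤ 1) (hβ : β₁ ≤ 1) (hγ : γ₁ ≤ 1) (h0 : β₀ + β₁ + α ≤ 2)
    (h1 : γ₂ + γ₁ + α ≤ 2) : GClause κ β₀ β₁ γ₁ γ₂ α :=
  fun q s hs hsi => gapClassMatch_layer q κ β₀ β₁ γ₁ γ₂ α hα hβ hγ h0 h1 s hs hsi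

/-- **DUALITY**: the clause of `(κ^rev, B^dual)` gives the clause of `(κ, B)` -/
theorem gdual (κ : Fin 4 → ℕ) (β₀ β₁ γ₁ γ₂ α : ℕ) (h : GClause ![κ 3, κ 2, κ 1, κ 0] γ₂ γ₁ β₁ β₀ α) : GClause κ β₀ β₁ γ₁ γ₂ α := by
  have e : (fun i => κ (Fin.rev i)) = ![κ 3, κ 2, κ 1, κ 0] := by
    funext i
    fin_cases i <;> rfl
  intro q s hs hsi
  exact gapClass_of_dual q κ β₀ β₁ γ₁ γ₂ α (by rw [e]; exact h q) s hs hsi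

/-- **D4, free t₂** -/
theorem gfreeT2 (κ : Fin 4 → ℕ) (β₀ β₁ γ₁ : ℕ) : GClause κ β₀ β₁ γ₁ 0 0 :=
  fun q s hs hsi => freeT2 _ β₀ β₁ γ₁ s hs (by rw [layerF_toT_monomial_fs κ q]; exact hsi)

/-- **D4, free t₁** -/
theorem gfreeT1 (κ : Fin 4 → ℕ) (β₀ γ₂ α : ℕ) : GClause κ β₀ 0 0 γ₂ α :=
  fun q s hs hsi => freeT1 _ β₀ γ₂ α s hs (by rw [layerF_toT_monomial_fs κ q]; exact hsi)

/-- **D4, free t₀** -/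
theorem gfreeT0 (κ : Fin 4 → ℕ) (β₁ γ₁ γ₂ : ℕ) : GClause κ 0 β₁ γ₁ γ₂ 0 :=
  fun q s hs hsi => freeT0 _ β₁ γ₁ γ₂ s hs (by rw [layerF_toT_monomial_fs κ q]; exact hsi)

/-- **D1** (`β₁, γ₁ ≥ 1`) -/
theorem gsplitD1 (κ : Fin 4 → ℕ) (b0 b c c2 al : ℕ)
    (hA₁ : Adm κ b0 b (c + 1) c2 al) (hG₁ : GClause κ b0 b (c + 1) c2 al)
    (hA₂ : Adm κ b0 (b + 1) c c2 al) (hG₂ : GClause κ b0 (b + 1) c c2 al) : GClause κ b0 (b + 1) (c + 1) c2 al := by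
  intro q s hs hsi
  have p₁ := piece κ q _ _ _ _ _ hA₁ hG₁
  have p₂ := piece κ q _ _ _ _ _ hA₂ hG₂
  exact splitD1 _ b0 b c c2 al p₁.1 p₁.2 p₂.1 p₂.2 s hs (by rw [layerF_toT_monomial_fs]; exact hsi)

/-- **D2** (`β₀, γ₂, α ≥ 1`) -/
theorem gsplitD2 (κ : Fin 4 → ℕ) (g b1 c1 h a : ℕ)
    (hA₁ : Adm κ (g + 1) b1 c1 h (a + 1)) (hG₁ : GClause κ (g + 1) b1 c1 h (a + 1))
    (hA₂ : Adm κ g b1 c1 (h + 1) (a + 1)) (hG₂ : GClause κ g b1 c1 (h + 1) (a + 1))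
    (hA₃ : Adm κ (g + 1) b1 c1 (h + 1) a) (hG₃ : GClause κ (g + 1) b1 c1 (h + 1) a) : GClause κ (g + 1) b1 c1 (h + 1) (a + 1) := by
  intro q s hs hsi
  have p₁ := piece κ q _ _ _ _ _ hA₁ hG₁
  have p₂ := piece κ q _ _ _ _ _ hA₂ hG₂
  have p₃ := piece_negT κ q _ _ _ _ _ hA₃ hG₃
  exact splitD2 _ g b1 c1 h a p₁.1 p₁.2 p₂.1 p₂.2 p₃.1 p₃.2 s hs (by rw [layerF_toT_monomial_fs]; exact hsi)

/-- re-assembling a consumed gap factor: `⇑(fs κ' + e_j) = κ` -/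
private theorem coe_fs_add_single_three (κ : Fin 4 → ℕ) (h : 1 ≤ κ 3) :
    ((fs ![κ 0, κ 1, κ 2, κ 3 - 1] + Finsupp.single 3 1 : Fin 4 →₀ ℕ) : Fin 4 → ℕ) = κ := by
  ext i
  fin_cases i <;> simp
  omega

/-- Auxiliary step `coe_fs_add_single_two` (§45): coe fs add single two. [bookkeeping] -/
private theorem coe_fs_add_single_two (κ : Fin 4 → ℕ) (h : 1 ≤ κ 2) :
    ((fs ![κ 0, κ 1, κ 2 - 1, κ 3] + Finsupp.single 2 1 : Fin 4 →₀ ℕ) : Fin 4 → ℕ) = κ := by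
  ext i
  fin_cases i <;> simp
  omega

/-- **D7** (`κ₃ ≥ 1`, `β₀, α ≥ 1`): pieces over `κ - e₃` -/
theorem gsplitD7 (κ : Fin 4 → ℕ) (g b1 c1 c2 a : ℕ) (hκ : 1 ≤ κ 3)
    (hA₁ : Adm ![κ 0, κ 1, κ 2, κ 3 - 1] g b1 c1 c2 (a + 1)) (hG₁ : GClause ![κ 0, κ 1, κ 2, κ 3 - 1] g b1 c1 c2 (a + 1))
    (hA₂ : Adm ![κ 0, κ 1, κ 2, κ 3 - 1] (g + 1) b1 c1 c2 a) (hG₂ : GClause ![κ 0, κ 1, κ 2, κ 3 - 1] (g + 1) b1 c1 c2 a) :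
    GClause κ (g + 1) b1 c1 c2 (a + 1) := by
  intro q s hs hsi
  have p₁ := piece _ q _ _ _ _ _ hA₁ hG₁
  have p₂ := piece_neg _ q _ _ _ _ _ hA₂ hG₂
  refine splitD7 _ g b1 c1 c2 a p₁.1 p₁.2 p₂.1 p₂.2 s hs fun z hz => ?_
  rw [hsi hz, ← pow_one (MvPolynomial.X 3 : MvPolynomial (Fin 4) ℚ), ← MvPolynomial.monomial_add_single,
    WordLayer.layerF_toT_monomial, coe_fs_add_single_three κ hκ]

/-- **D8** (`κ₂ ≥ 1`, `γ₁, γ₂ ≥ 1`): pieces over `κ - e₂` -/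
theorem gsplitD8 (κ : Fin 4 → ℕ) (b0 b1 c h al : ℕ) (hκ : 1 ≤ κ 2)
    (hA₁ : Adm ![κ 0, κ 1, κ 2 - 1, κ 3] b0 b1 (c + 1) h al) (hG₁ : GClause ![κ 0, κ 1, κ 2 - 1, κ 3] b0 b1 (c + 1) h al)
    (hA₂ : Adm ![κ 0, κ 1, κ 2 - 1, κ 3] b0 b1 c (h + 1) al) (hG₂ : GClause ![κ 0, κ 1, κ 2 - 1, κ 3] b0 b1 c (h + 1) al) :
    GClause κ b0 b1 (c + 1) (h + 1) al := by
  intro q s hs hsi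
  have p₁ := piece _ q _ _ _ _ _ hA₁ hG₁
  have p₂ := piece_neg _ q _ _ _ _ _ hA₂ hG₂
  refine splitD8 _ b0 b1 c h al p₁.1 p₁.2 p₂.1 p₂.2 s hs fun z hz => ?_
  rw [hsi hz, ← pow_one (MvPolynomial.X 2 : MvPolynomial (Fin 4) ℚ), ← MvPolynomial.monomial_add_single,
    WordLayer.layerF_toT_monomial, coe_fs_add_single_two κ hκ]

/-- **D9** (`κ₂ ≥ 1`, `β₀, β₁, α ≥ 1`): pieces over `κ - e₂` -/
theorem gsplitD9 (κ : Fin 4 → ℕ) (g b c1 c2 a : ℕ) (hκ : 1 ≤ κ 2)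
    (hA₁ : Adm ![κ 0, κ 1, κ 2 - 1, κ 3] (g + 1) b c1 c2 (a + 1)) (hG₁ : GClause ![κ 0, κ 1, κ 2 - 1, κ 3] (g + 1) b c1 c2 (a + 1))
    (hA₂ : Adm ![κ 0, κ 1, κ 2 - 1, κ 3] g (b + 1) c1 c2 (a + 1)) (hG₂ : GClause ![κ 0, κ 1, κ 2 - 1, κ 3] g (b + 1) c1 c2 (a + 1))
    (hA₃ : Adm ![κ 0, κ 1, κ 2 - 1, κ 3] (g + 1) (b + 1) c1 c2 a) (hG₃ : GClause ![κ 0, κ 1, κ 2 - 1, κ 3] (g + 1) (b + 1) c1 c2 a) :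
    GClause κ (g + 1) (b + 1) c1 c2 (a + 1) := by
  intro q s hs hsi
  have p₁ := piece _ q _ _ _ _ _ hA₁ hG₁
  have p₂ := piece_neg _ q _ _ _ _ _ hA₂ hG₂
  have p₃ := piece _ q _ _ _ _ _ hA₃ hG₃
  refine splitD9 _ g b c1 c2 a p₁.1 p₁.2 p₂.1 p₂.2 p₃.1 p₃.2 s hs fun z hz => ?_
  rw [hsi hz, ← pow_one (MvPolynomial.X 2 : MvPolynomial (Fin 4) ℚ), ← MvPolynomial.monomial_add_single,
    WordLayer.layerF_toT_monomial, coe_fs_add_single_two κ hκ]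

/-- **D6** (`γ₂ = 0`, `α = a+1 ≥ 2`, `β₁ ≤ 1`): every admissible datum over `(β₀,β₁,γ₁,1,a)` ⟹ the class (§42 `ruleD6`) -/
theorem gruleD6 (κ : Fin 4 → ℕ) (β₀ β₁ γ₁ a : ℕ) (ha : 1 ≤ a) (hβ₁ : β₁ ≤ 1) (hA : Adm κ β₀ β₁ γ₁ 0 (a + 1))
    (IH : ∀ κ' : Fin 4 → ℕ, Adm κ' β₀ β₁ γ₁ 1 a → GClause κ' β₀ β₁ γ₁ 1 a) : GClause κ β₀ β₁ γ₁ 0 (a + 1) := by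
  intro q s hs hsi
  obtain ⟨hV0, hB1, hAl, hC1, hV3⟩ := hA
  exact ruleD6 (fs κ) q β₀ β₁ γ₁ a ha hβ₁ (by simpa using hV0) (by simpa using hB1) (by simpa using hAl) (by simpa using hC1)
    (by simpa using hV3) (fun q' κ' h1 h2 h3 h4 h5 s' hs' hsi' => IH κ' ⟨h1, h2, h3, h4, h5⟩ q' s' hs' hsi') s hs
    (by simpa using hsi)

/-- **D5, case `κ₀ ≥ 1`** (`γ₂ = g+1 ≥ 2`, `β₁, γ₁ ≤ 1`): every admissible datum over `(β₀,β₁,γ₁,g,a+1)` ⟹ the class.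
Proof: `lowerC2G` with `H = q·g^{κ̃+e₀}`, short `Q = -(q/g)·g^{κ̃}`, remainder = the six classes of `d5a_numer`. -/
theorem gruleD5a (κ : Fin 4 → ℕ) (β₀ β₁ γ₁ g a : ℕ) (hκ : 1 ≤ κ 0) (hg : 1 ≤ g) (hβ₁ : β₁ ≤ 1) (hγ₁ : γ₁ ≤ 1)
    (hA : Adm κ β₀ β₁ γ₁ (g + 1) a) (IH : ∀ κ' : Fin 4 → ℕ, Adm κ' β₀ β₁ γ₁ g (a + 1) → GClause κ' β₀ β₁ γ₁ g (a + 1)) :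
    GClause κ β₀ β₁ γ₁ (g + 1) a := by
  intro q r hd hi
  obtain ⟨hV0, hB1, hAl, hC1, hV3⟩ := hA
  set κt : Fin 4 →₀ ℕ := fs ![κ 0 - 1, κ 1, κ 2, κ 3] with hκt
  have e0 : κt 0 + 1 = κ 0 := by simp [hκt]; omega
  have e1 : κt 1 = κ 1 := by simp [hκt]
  have e2 : κt 2 = κ 2 := by simp [hκt]
  have e3 : κt 3 = κ 3 := by simp [hκt]
  have hκ' : ((κt + Finsupp.single 0 1 : Fin 4 →₀ ℕ) : Fin 4 → ℕ) = κ := by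
    ext i
    fin_cases i <;> simp [hκt]
    omega
  have hadm : ∀ j : Fin 6, Adm (WordLayer.d5aK κt j) β₀ β₁ γ₁ g (a + 1) := by
    intro j
    fin_cases j <;> simp [Adm, WordLayer.d5aK, WordLayer.gshift, e1, e2, e3] <;> omega
  have hsum : ∀ z ∈ KZ.openOrderedSimplex 3,
      WordLayer.layerF (WordLayer.toT (WordLayer.gRc2Q (MvPolynomial.monomial (κt + Finsupp.single 0 1) q)
        (MvPolynomial.monomial κt (-(q / g))) g a)) β₀ β₁ γ₁ g (a + 1) z =
      ∑ j ∈ (Finset.univ : Finset (Fin 6)), (WordLayer.d5aC κt q g a j : ℝ) * WordLayer.gapF (WordLayer.d5aK κt j) β₀ β₁ γ₁ g (a + 1) z :=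
    fun z hz => WordLayer.layerF_toT_of_numer _ _ _ _ β₀ β₁ γ₁ g (a + 1) (WordLayer.d5a_numer hz κt q g a hg)
  have pack := WordLayer.sum_pack3 (layerThree ∪ gzLETwo) (Finset.univ : Finset (Fin 6))
    (fun j t => (WordLayer.d5aC κt q g a j : ℝ) * WordLayer.gapF (WordLayer.d5aK κt j) β₀ β₁ γ₁ g (a + 1) t)
    (fun j _ => WordLayer.gapF_smul_sa _ _ β₀ β₁ γ₁ g (a + 1))
    (fun j _ => (WordLayer.gapClass_integrableOn _ (hadm j).1 (hadm j).2.1 (hadm j).2.2.1 (hadm j).2.2.2.1 (hadm j).2.2.2.2).const_mul _)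
    (fun j _ s hs hsi => IH _ (hadm j) _ s hs hsi)
  have hRint : IntegrableOn (WordLayer.layerF (WordLayer.toT (WordLayer.gRc2Q (MvPolynomial.monomial (κt + Finsupp.single 0 1) q)
      (MvPolynomial.monomial κt (-(q / g))) g a)) β₀ β₁ γ₁ g (a + 1)) (KZ.openOrderedSimplex 3) :=
    pack.2.1.congr_fun (fun z hz => (hsum z hz).symm) (measurableSet_simplex 3)
  have hR : ∀ s : KZ.IntegralRep 3, s.domain = simplex 3 →
      EqOn s.integrand (WordLayer.layerF (WordLayer.toT (WordLayer.gRc2Q (MvPolynomial.monomial (κt + Finsupp.single 0 1) q)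
        (MvPolynomial.monomial κt (-(q / g))) g a)) β₀ β₁ γ₁ g (a + 1)) s.domain → CongInto (layerThree ∪ gzLETwo) (KZ.of s) := by
    intro s hs hsi
    refine pack.2.2 s hs fun z hz => ?_
    have hz' : z ∈ KZ.openOrderedSimplex 3 := by rw [hs] at hz; exact hz
    rw [hsi hz, hsum z hz']
  refine lowerC2G _ _ β₀ β₁ γ₁ g a hg hRint hR r hd fun z hz => ?_
  rw [hi hz, WordLayer.layerF_toT_monomial, hκ']

/-- **D5, case `κ₀ = 0`**: `H = q·g^κ·SIG`, `Q = -(q/g)·g^κ`, remainder = the four classes of `d5b_numer`. -/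
theorem gruleD5b (κ : Fin 4 → ℕ) (β₀ β₁ γ₁ g a : ℕ) (hκ : κ 0 = 0) (hg : 1 ≤ g) (hβ₁ : β₁ ≤ 1) (hγ₁ : γ₁ ≤ 1)
    (hA : Adm κ β₀ β₁ γ₁ (g + 1) a) (IH : ∀ κ' : Fin 4 → ℕ, Adm κ' β₀ β₁ γ₁ g (a + 1) → GClause κ' β₀ β₁ γ₁ g (a + 1)) :
    GClause κ β₀ β₁ γ₁ (g + 1) a := by
  intro q r hd hi
  obtain ⟨hV0, hB1, hAl, hC1, hV3⟩ := hA
  have hadm : ∀ j : Fin 4, Adm (WordLayer.d5bK (fs κ) j) β₀ β₁ γ₁ g (a + 1) := by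
    intro j
    fin_cases j <;> simp [Adm, WordLayer.d5bK, WordLayer.gshift] <;> omega
  have hsum : ∀ z ∈ KZ.openOrderedSimplex 3,
      WordLayer.layerF (WordLayer.toT (WordLayer.gRc2Q (MvPolynomial.monomial (fs κ) q * WordLayer.gsum)
        (MvPolynomial.monomial (fs κ) (-(q / g))) g a)) β₀ β₁ γ₁ g (a + 1) z =
      ∑ j ∈ (Finset.univ : Finset (Fin 4)), (WordLayer.d5bC (fs κ) q g a j : ℝ) * WordLayer.gapF (WordLayer.d5bK (fs κ) j) β₀ β₁ γ₁ g (a + 1) z :=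
    fun z hz => WordLayer.layerF_toT_of_numer _ _ _ _ β₀ β₁ γ₁ g (a + 1) (WordLayer.d5b_numer hz (fs κ) q g a hg)
  have pack := WordLayer.sum_pack3 (layerThree ∪ gzLETwo) (Finset.univ : Finset (Fin 4))
    (fun j t => (WordLayer.d5bC (fs κ) q g a j : ℝ) * WordLayer.gapF (WordLayer.d5bK (fs κ) j) β₀ β₁ γ₁ g (a + 1) t)
    (fun j _ => WordLayer.gapF_smul_sa _ _ β₀ β₁ γ₁ g (a + 1))
    (fun j _ => (WordLayer.gapClass_integrableOn _ (hadm j).1 (hadm j).2.1 (hadm j).2.2.1 (hadm j).2.2.2.1 (hadm j).2.2.2.2).const_mul _)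
    (fun j _ s hs hsi => IH _ (hadm j) _ s hs hsi)
  have hRint : IntegrableOn (WordLayer.layerF (WordLayer.toT (WordLayer.gRc2Q (MvPolynomial.monomial (fs κ) q * WordLayer.gsum)
      (MvPolynomial.monomial (fs κ) (-(q / g))) g a)) β₀ β₁ γ₁ g (a + 1)) (KZ.openOrderedSimplex 3) :=
    pack.2.1.congr_fun (fun z hz => (hsum z hz).symm) (measurableSet_simplex 3)
  have hR : ∀ s : KZ.IntegralRep 3, s.domain = simplex 3 →
      EqOn s.integrand (WordLayer.layerF (WordLayer.toT (WordLayer.gRc2Q (MvPolynomial.monomial (fs κ) q * WordLayer.gsum)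
        (MvPolynomial.monomial (fs κ) (-(q / g))) g a)) β₀ β₁ γ₁ g (a + 1)) s.domain → CongInto (layerThree ∪ gzLETwo) (KZ.of s) := by
    intro s hs hsi
    refine pack.2.2 s hs fun z hz => ?_
    have hz' : z ∈ KZ.openOrderedSimplex 3 := by rw [hs] at hz; exact hz
    rw [hsi hz, hsum z hz']
  refine lowerC2G _ _ β₀ β₁ γ₁ g a hg hRint hR r hd fun z hz => ?_
  rw [hi hz, WordLayer.toT_mul_gsum, WordLayer.layerF_toT_monomial, coe_fs]

/-- **D3, case `κ₃ ≥ 1`** (`β₁ = b+1 ≥ 2`, `γ₁ = 0`): every admissible datum over `(β₀,b,1,γ₂,α)` ⟹ the class.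
Proof: `lowerT1G` with `H = q·g^{κ̃+e₃}`, short `Q = (q/b)·g^{κ̃}`, remainder = the four classes of `d3a_numer`. -/
theorem gruleD3a (κ : Fin 4 → ℕ) (β₀ b γ₂ α : ℕ) (hκ : 1 ≤ κ 3) (hb : 1 ≤ b) (hA : Adm κ β₀ (b + 1) 0 γ₂ α)
    (IH : ∀ κ' : Fin 4 → ℕ, Adm κ' β₀ b 1 γ₂ α → GClause κ' β₀ b 1 γ₂ α) : GClause κ β₀ (b + 1) 0 γ₂ α := by
  intro q r hd hi
  obtain ⟨hV0, hB1, hAl, hC1, hV3⟩ := hA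
  set κt : Fin 4 →₀ ℕ := fs ![κ 0, κ 1, κ 2, κ 3 - 1] with hκt
  have e0 : κt 0 = κ 0 := by simp [hκt]
  have e1 : κt 1 = κ 1 := by simp [hκt]
  have e2 : κt 2 = κ 2 := by simp [hκt]
  have e3 : κt 3 + 1 = κ 3 := by simp [hκt]; omega
  have hκ' : ((κt + Finsupp.single 3 1 : Fin 4 →₀ ℕ) : Fin 4 → ℕ) = κ := by
    ext i
    fin_cases i <;> simp [hκt]
    omega
  have hadm : ∀ j : Fin 4, Adm (WordLayer.d3aK κt j) β₀ b 1 γ₂ α := by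
    intro j
    fin_cases j <;> simp [Adm, WordLayer.d3aK, WordLayer.gshift, e0, e1, e2] <;> omega
  have hsum : ∀ z ∈ KZ.openOrderedSimplex 3,
      WordLayer.layerF (WordLayer.toT (WordLayer.gR1Q (MvPolynomial.monomial (κt + Finsupp.single 3 1) q)
        (MvPolynomial.monomial κt (q / b)) b 0)) β₀ b 1 γ₂ α z =
      ∑ j ∈ (Finset.univ : Finset (Fin 4)), (WordLayer.d3aC κt q b j : ℝ) * WordLayer.gapF (WordLayer.d3aK κt j) β₀ b 1 γ₂ α z :=
    fun z hz => WordLayer.layerF_toT_of_numer _ _ _ _ β₀ b 1 γ₂ α (WordLayer.d3a_numer hz κt q b hb)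
  have pack := WordLayer.sum_pack3 (layerThree ∪ gzLETwo) (Finset.univ : Finset (Fin 4))
    (fun j t => (WordLayer.d3aC κt q b j : ℝ) * WordLayer.gapF (WordLayer.d3aK κt j) β₀ b 1 γ₂ α t)
    (fun j _ => WordLayer.gapF_smul_sa _ _ β₀ b 1 γ₂ α)
    (fun j _ => (WordLayer.gapClass_integrableOn _ (hadm j).1 (hadm j).2.1 (hadm j).2.2.1 (hadm j).2.2.2.1 (hadm j).2.2.2.2).const_mul _)
    (fun j _ s hs hsi => IH _ (hadm j) _ s hs hsi)
  have hRint : IntegrableOn (WordLayer.layerF (WordLayer.toT (WordLayer.gR1Q (MvPolynomial.monomial (κt + Finsupp.single 3 1) q)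
      (MvPolynomial.monomial κt (q / b)) b 0)) β₀ b (0 + 1) γ₂ α) (KZ.openOrderedSimplex 3) := by
    rw [Nat.zero_add]
    exact pack.2.1.congr_fun (fun z hz => (hsum z hz).symm) (measurableSet_simplex 3)
  have hR : ∀ s : KZ.IntegralRep 3, s.domain = simplex 3 →
      EqOn s.integrand (WordLayer.layerF (WordLayer.toT (WordLayer.gR1Q (MvPolynomial.monomial (κt + Finsupp.single 3 1) q)
        (MvPolynomial.monomial κt (q / b)) b 0)) β₀ b (0 + 1) γ₂ α) s.domain → CongInto (layerThree ∪ gzLETwo) (KZ.of s) := by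
    intro s hs hsi
    refine pack.2.2 s hs fun z hz => ?_
    have hz' : z ∈ KZ.openOrderedSimplex 3 := by rw [hs] at hz; exact hz
    rw [hsi hz, Nat.zero_add, hsum z hz']
  refine lowerT1G _ _ β₀ b 0 γ₂ α hb hRint hR r hd fun z hz => ?_
  rw [hi hz, WordLayer.layerF_toT_monomial, hκ']

/-- **D3, case `κ₃ = 0`**: `H = q·g^κ·SIG`, `Q = (q/b)·g^κ`, remainder = the six classes of `d3b_numer`. -/
theorem gruleD3b (κ : Fin 4 → ℕ) (β₀ b γ₂ α : ℕ) (hκ : κ 3 = 0) (hb : 1 ≤ b) (hA : Adm κ β₀ (b + 1) 0 γ₂ α)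
    (IH : ∀ κ' : Fin 4 → ℕ, Adm κ' β₀ b 1 γ₂ α → GClause κ' β₀ b 1 γ₂ α) : GClause κ β₀ (b + 1) 0 γ₂ α := by
  intro q r hd hi
  obtain ⟨hV0, hB1, hAl, hC1, hV3⟩ := hA
  have hadm : ∀ j : Fin 6, Adm (WordLayer.d3bK (fs κ) j) β₀ b 1 γ₂ α := by
    intro j
    fin_cases j <;> simp [Adm, WordLayer.d3bK, WordLayer.gshift] <;> omega
  have hsum : ∀ z ∈ KZ.openOrderedSimplex 3,
      WordLayer.layerF (WordLayer.toT (WordLayer.gR1Q (MvPolynomial.monomial (fs κ) q * WordLayer.gsum)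
        (MvPolynomial.monomial (fs κ) (q / b)) b 0)) β₀ b 1 γ₂ α z =
      ∑ j ∈ (Finset.univ : Finset (Fin 6)), (WordLayer.d3bC (fs κ) q b j : ℝ) * WordLayer.gapF (WordLayer.d3bK (fs κ) j) β₀ b 1 γ₂ α z :=
    fun z hz => WordLayer.layerF_toT_of_numer _ _ _ _ β₀ b 1 γ₂ α (WordLayer.d3b_numer hz (fs κ) q b hb)
  have pack := WordLayer.sum_pack3 (layerThree ∪ gzLETwo) (Finset.univ : Finset (Fin 6))
    (fun j t => (WordLayer.d3bC (fs κ) q b j : ℝ) * WordLayer.gapF (WordLayer.d3bK (fs κ) j) β₀ b 1 γ₂ α t)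
    (fun j _ => WordLayer.gapF_smul_sa _ _ β₀ b 1 γ₂ α)
    (fun j _ => (WordLayer.gapClass_integrableOn _ (hadm j).1 (hadm j).2.1 (hadm j).2.2.1 (hadm j).2.2.2.1 (hadm j).2.2.2.2).const_mul _)
    (fun j _ s hs hsi => IH _ (hadm j) _ s hs hsi)
  have hRint : IntegrableOn (WordLayer.layerF (WordLayer.toT (WordLayer.gR1Q (MvPolynomial.monomial (fs κ) q * WordLayer.gsum)
      (MvPolynomial.monomial (fs κ) (q / b)) b 0)) β₀ b (0 + 1) γ₂ α) (KZ.openOrderedSimplex 3) := by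
    rw [Nat.zero_add]
    exact pack.2.1.congr_fun (fun z hz => (hsum z hz).symm) (measurableSet_simplex 3)
  have hR : ∀ s : KZ.IntegralRep 3, s.domain = simplex 3 →
      EqOn s.integrand (WordLayer.layerF (WordLayer.toT (WordLayer.gR1Q (MvPolynomial.monomial (fs κ) q * WordLayer.gsum)
        (MvPolynomial.monomial (fs κ) (q / b)) b 0)) β₀ b (0 + 1) γ₂ α) s.domain → CongInto (layerThree ∪ gzLETwo) (KZ.of s) := by
    intro s hs hsi
    refine pack.2.2 s hs fun z hz => ?_
    have hz' : z ∈ KZ.openOrderedSimplex 3 := by rw [hs] at hz; exact hz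
    rw [hsi hz, Nat.zero_add, hsum z hz']
  refine lowerT1G _ _ β₀ b 0 γ₂ α hb hRint hR r hd fun z hz => ?_
  rw [hi hz, WordLayer.toT_mul_gsum, WordLayer.layerF_toT_monomial, coe_fs]

end GapClassRules

end Summit.KontsevichZagierPeriods.KontsevichZagierPeriods.Cruxes.GZNormalFormWThree.GZLadder
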